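import Mathlib
import Summits.Ventures.PercRepro2.Defs
import Summits.Ventures.PercRepro2.Independence
import Summits.Ventures.PercRepro2.Harris
import Summits.Ventures.PercRepro2.Graph
import Summits.Ventures.PercRepro2.Exploration
import Summits.Ventures.PercRepro2.GriffithsOne
import Summits.Ventures.PercRepro2.PartDefs

/-!
# The core-free union theorem (PART), part 3: the Ising sum (blind cell PercRepro2, typer-1;
mine-1 g9 `proofs/MINE1-IID-UNION.md` §2 "Griffiths' first inequality for the ferromagnetic Ising
model on the branch graph")

For a fixed spanning `η`, summing the cross-edge weight `Π_{cross(τ)} (1 − p_e) · 1[η closed on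
cross(τ)]` over the partitions `τ` is an Ising sum: edge by edge,
`[e cross] (1 − p_e) · [η e = false ∨ e not cross] = α_e(η) + β_e(η) σ_u σ_v` with
`(α, β) = (½, ½)` on an `η`-OPEN free edge (infinite coupling: the ends must agree), `((2 − p_e)/2,
p_e/2)` on an `η`-CLOSED free edge (coupling `q_e = 1 − p_e`), and `(1, 0)` on loops and edges at
`l` (`cross_factor_eq`). mine-1's branches are not needed: the couplings live on the edges directly.

* `griffiths_one_finset`: Griffiths' first inequality with the interaction indexed by a finset of
  edges with endpoint maps (the `Finset` form of `Griffiths.griffiths_one`);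
* **`inner_nonneg`**: `0 ≤ Σ_{τ, τ l = false} σ_x σ_y Π_e (α_e + β_e σ_{u_e} σ_{v_e})` for `x, y ≠ l`
  — the restriction `τ l = false` is removed by the flip `τ ↦ τ[l ↦ ¬τ l]`, which fixes the summand
  (no coupling touches `l`), so the restricted sum is half the unrestricted one.
-/

namespace Summit.Ventures.PercRepro2

namespace Part

open Griffiths

open scoped Classical

/-! ## Griffiths' first inequality, `Finset` form -/

section GriffithsFinset

variable {R : Type*} [CommRing R] [LinearOrder R] [IsStrictOrderedRing R]
  {ι : Type*} [Fintype ι] [DecidableEq ι] {E : Type*}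

/-- **Griffiths' first inequality**, interaction indexed by a finset `F` of edges with endpoint
maps `u v : E → ι`: for `α, β ≥ 0` on `F`,
`0 ≤ Σ_σ σ^a · Π_{e ∈ F} (α e + β e σ_{u e} σ_{v e})`. -/
theorem griffiths_one_finset (a : ι → ℕ) (F : Finset E) (u v : E → ι) (α β : E → R)
    (h : ∀ e ∈ F, 0 ≤ α e ∧ 0 ≤ β e) :
    (0 : R) ≤ ∑ b : ι → Bool, spinPow a b *
      ∏ e ∈ F, (α e + β e * spin (b (u e)) * spin (b (v e))) := by
  induction F using Finset.induction_on generalizing a with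
  | empty =>
    simp only [Finset.prod_empty, mul_one]
    exact sum_spinPow_nonneg a
  | insert e F he ih =>
    have hα : 0 ≤ α e := (h e (Finset.mem_insert_self e F)).1
    have hβ : 0 ≤ β e := (h e (Finset.mem_insert_self e F)).2
    have h' : ∀ e' ∈ F, 0 ≤ α e' ∧ 0 ≤ β e' := fun e' he' => h e' (Finset.mem_insert_of_mem he')
    simp only [Finset.prod_insert he]
    have hsplit : ∀ b : ι → Bool, spinPow a b *
        ((α e + β e * spin (b (u e)) * spin (b (v e))) *
          ∏ e' ∈ F, (α e' + β e' * spin (b (u e')) * spin (b (v e')))) =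
        α e * (spinPow a b * ∏ e' ∈ F, (α e' + β e' * spin (b (u e')) * spin (b (v e')))) +
        β e * (spinPow (a + Pi.single (u e) 1 + Pi.single (v e) 1) b *
          ∏ e' ∈ F, (α e' + β e' * spin (b (u e')) * spin (b (v e')))) := by
      intro b
      rw [← spinPow_mul_spin, ← spinPow_mul_spin]
      ring
    simp_rw [hsplit]
    rw [Finset.sum_add_distrib, ← Finset.mul_sum, ← Finset.mul_sum]
    exact add_nonneg (mul_nonneg hα (ih a h')) (mul_nonneg hβ (ih _ h'))

omit [LinearOrder R] [IsStrictOrderedRing R] in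
/-- `σ^{e_x + e_y} = σ_x σ_y`. -/
lemma spinPow_single_add_single (x y : ι) (b : ι → Bool) :
    spinPow (Pi.single x 1 + Pi.single y 1) b = (spin (b x) : R) * spin (b y) := by
  have h0 : spinPow (0 : ι → ℕ) b = (1 : R) := by simp [spinPow]
  rw [← zero_add (Pi.single x 1 + Pi.single y 1), ← add_assoc, ← spinPow_mul_spin,
    ← spinPow_mul_spin, h0, one_mul]

end GriffithsFinset

/-! ## The couplings of a configuration -/

section Couplings

variable {V : Type*} {E : Type*} {R : Type*} [Field R] [LinearOrder R] [IsStrictOrderedRing R]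

variable (ends : E → Sym2 V) (l : V)

/-- A choice of first end of every edge. -/
noncomputable def fst (e : E) : V := (ends e).out.1

/-- A choice of second end of every edge. -/
noncomputable def snd (e : E) : V := (ends e).out.2

/-- `ends e = s(fst e, snd e)`. -/
lemma ends_eq_fst_snd (e : E) : ends e = s(fst ends e, snd ends e) := (Quot.out_eq (ends e)).symm

/-- A free edge: a non-loop edge away from `l`. -/
def freeEdge (e : E) : Prop := ¬ (ends e).IsDiag ∧ fst ends e ≠ l ∧ snd ends e ≠ l

variable (p : E → R)

/-- The Ising coupling `α_e(η)`: `½` on an open free edge, `(2 − p_e)/2` on a closed free edge,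
`1` on loops and root edges. -/
noncomputable def alpha (η : Config E) (e : E) : R :=
  if freeEdge ends l e then (if η e then 1 / 2 else (2 - p e) / 2) else 1

/-- The Ising coupling `β_e(η)`: `½` on an open free edge, `p_e / 2` on a closed free edge,
`0` on loops and root edges. -/
noncomputable def beta (η : Config E) (e : E) : R :=
  if freeEdge ends l e then (if η e then 1 / 2 else p e / 2) else 0

variable {ends l p}

/-- `α ≥ 0` for admissible weights. -/
lemma alpha_nonneg (hp : IsProbVec p) (η : Config E) (e : E) : 0 ≤ alpha ends l p η e := by
  unfold alpha
  split_ifs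
  · norm_num
  · have := hp.le_one e; linarith
  · exact zero_le_one

/-- `β ≥ 0` for admissible weights. -/
lemma beta_nonneg (hp : IsProbVec p) (η : Config E) (e : E) : 0 ≤ beta ends l p η e := by
  unfold beta
  split_ifs
  · norm_num
  · have := hp.nonneg e; linarith
  · exact le_rfl

/-- A cross edge is free. -/
lemma freeEdge_of_crossEdge {τ : V → Bool} {e : E} (h : crossEdge ends l τ e) :
    freeEdge ends l e := by
  have hc := (crossEdge_comm (ends_eq_fst_snd ends e)).1 h
  exact ⟨crossEdge_not_isDiag h, hc.1, hc.2.1⟩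

/-- On a free edge, "cross" means "the ends differ under `τ`". -/
lemma crossEdge_iff_of_freeEdge {τ : V → Bool} {e : E} (h : freeEdge ends l e) :
    crossEdge ends l τ e ↔ τ (fst ends e) ≠ τ (snd ends e) := by
  rw [crossEdge_comm (ends_eq_fst_snd ends e)]
  exact ⟨fun h' => h'.2.2, fun h' => ⟨h.2.1, h.2.2, h'⟩⟩

/-- **The per-edge identity**: the cross-edge weight with its closure indicator is the Ising factor
`α_e(η) + β_e(η) σ_{u_e} σ_{v_e}`. -/
lemma cross_factor_edge (η : Config E) (τ : V → Bool) (e : E) :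
    (if crossEdge ends l τ e then 1 - p e else 1) *
        (if (crossEdge ends l τ e → η e = false) then 1 else 0) =
      alpha ends l p η e + beta ends l p η e * spin (τ (fst ends e)) * spin (τ (snd ends e)) := by
  unfold alpha beta
  by_cases hf : freeEdge ends l e
  · rw [if_pos hf, if_pos hf, crossEdge_iff_of_freeEdge hf]
    by_cases hτ : τ (fst ends e) = τ (snd ends e)
    · rw [if_neg (fun h => h hτ), if_pos (fun h => absurd hτ h), hτ, mul_assoc, spin_mul_self]
      cases η e <;> simp only [Bool.false_eq_true, ite_true, ite_false, mul_one] <;> ring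
    · have hs : (spin (τ (fst ends e)) : R) * spin (τ (snd ends e)) = -1 := by
        cases h1 : τ (fst ends e) <;> cases h2 : τ (snd ends e) <;> simp_all [spin]
      rw [if_pos hτ, mul_assoc, hs]
      simp only [imp_iff_right hτ]
      cases η e <;>
        simp only [Bool.false_eq_true, Bool.true_eq_false, ite_true, ite_false, mul_one,
          mul_zero] <;> ring
  · have hnc : ¬ crossEdge ends l τ e := fun h => hf (freeEdge_of_crossEdge h)
    rw [if_neg hf, if_neg hf, if_neg hnc, if_pos (fun h => absurd h hnc)]
    ring

variable [Fintype E] [DecidableEq E]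

omit [DecidableEq E] in
/-- **The cross weight as an Ising product**:
`Π_{cross(τ)} (1 − p_e) · 1[η ∈ crossClosed τ] = Π_e (α_e + β_e σ_{u_e} σ_{v_e})`. -/
lemma cross_factor_eq (η : Config E) (τ : V → Bool) :
    (∏ e, if crossEdge ends l τ e then 1 - p e else 1) * (crossClosed ends l τ).indicator 1 η =
      ∏ e, (alpha ends l p η e + beta ends l p η e * spin (τ (fst ends e)) * spin (τ (snd ends e))) := by
  have hind : (crossClosed ends l τ).indicator (1 : Config E → R) η =
      ∏ e, if (crossEdge ends l τ e → η e = false) then 1 else 0 := by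
    rw [Finset.prod_boole, Set.indicator_apply]
    simp [crossClosed]
  rw [hind, ← Finset.prod_mul_distrib]
  exact Finset.prod_congr rfl fun e _ => cross_factor_edge η τ e

end Couplings

/-! ## The inner sum -/

section Inner

variable {V : Type*} {E : Type*} [Fintype V] [DecidableEq V] [Fintype E] [DecidableEq E]
  {R : Type*} [Field R] [LinearOrder R] [IsStrictOrderedRing R]

variable (ends : E → Sym2 V) (l : V) (p : E → R)

/-- The Ising summand of a partition `τ`: `σ_x σ_y Π_e (α_e + β_e σ_{u_e} σ_{v_e})`. -/
noncomputable def isingTerm (η : Config E) (x y : V) (τ : V → Bool) : R :=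
  spin (τ x) * spin (τ y) *
    ∏ e, (alpha ends l p η e + beta ends l p η e * spin (τ (fst ends e)) * spin (τ (snd ends e)))

variable {ends l p}

omit [Fintype V] [DecidableEq E] [LinearOrder R] [IsStrictOrderedRing R] in
/-- Flipping the colour of `l` does not change the summand (`x, y ≠ l`, no coupling at `l`). -/
lemma isingTerm_flip (η : Config E) {x y : V} (hx : x ≠ l) (hy : y ≠ l) (τ : V → Bool) :
    isingTerm ends l p η x y (flipEdge l τ) = isingTerm ends l p η x y τ := by
  unfold isingTerm
  rw [flipEdge_apply_of_ne hx, flipEdge_apply_of_ne hy]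
  congr 1
  refine Finset.prod_congr rfl fun e _ => ?_
  by_cases hf : freeEdge ends l e
  · rw [flipEdge_apply_of_ne hf.2.1, flipEdge_apply_of_ne hf.2.2]
  · simp only [beta, if_neg hf, zero_mul]

omit [DecidableEq E] in
/-- Griffiths: the unrestricted Ising sum is nonnegative. -/
lemma sum_isingTerm_nonneg (hp : IsProbVec p) (η : Config E) (x y : V) :
    0 ≤ ∑ τ : V → Bool, isingTerm ends l p η x y τ := by
  have := griffiths_one_finset (Pi.single x 1 + Pi.single y 1) (Finset.univ : Finset E)
    (fst ends) (snd ends) (alpha ends l p η) (beta ends l p η)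
    (fun e _ => ⟨alpha_nonneg hp η e, beta_nonneg hp η e⟩)
  simpa only [spinPow_single_add_single, isingTerm] using this

omit [DecidableEq E] in
/-- **The inner sum**: `0 ≤ Σ_{τ l = false} σ_x σ_y Π_e (α_e + β_e σ_{u_e} σ_{v_e})` for `x, y ≠ l`. -/
theorem inner_nonneg (hp : IsProbVec p) (η : Config E) {x y : V} (hx : x ≠ l) (hy : y ≠ l) :
    0 ≤ ∑ τ : V → Bool, if τ l = false then isingTerm ends l p η x y τ else 0 := by
  -- the two halves of the unrestricted sum are equal
  have hsplit : ∑ τ : V → Bool, isingTerm ends l p η x y τ =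
      (∑ τ : V → Bool, if τ l = false then isingTerm ends l p η x y τ else 0) +
        ∑ τ : V → Bool, if τ l = true then isingTerm ends l p η x y τ else 0 := by
    rw [← Finset.sum_add_distrib]
    refine Finset.sum_congr rfl fun τ _ => ?_
    cases τ l <;> simp
  have hflip : (∑ τ : V → Bool, if τ l = true then isingTerm ends l p η x y τ else 0) =
      ∑ τ : V → Bool, if τ l = false then isingTerm ends l p η x y τ else 0 := by
    refine Fintype.sum_equiv (flipEdgeEquiv l) _ _ fun τ => ?_
    show (if τ l = true then isingTerm ends l p η x y τ else 0) =
      (if flipEdge l τ l = false then isingTerm ends l p η x y (flipEdge l τ) else 0)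
    rw [isingTerm_flip η hx hy]
    simp only [flipEdge, Function.update_self]
    cases τ l <;> simp
  have h := sum_isingTerm_nonneg (ends := ends) (l := l) hp η x y
  rw [hsplit, hflip] at h
  linarith

end Inner

end Part

end Summit.Ventures.PercRepro2
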